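import Literature.NumberTheory.Weil1964.AdelicMetaplecticDirectSum
import Literature.NumberTheory.Automorphic.FiniteAdeleSchrodingerIrreducible
import HarnessLib

/-!
# The finite implementers of the adelic metaplectic group

Topic `NumberTheory/Weil1964`; namespace `Literature.NumberTheory.Weil1964`. Origin: `pub-hodgecm`
MODEL-CONSTRUCTION sub-cell, node W2-⊗ / (⊗S)-𝔸 (iii), finite-implementer seam (F2). KERNEL MATHEMATICS ONLY:
every declaration below is proved; no `def … : Prop` record, no cited hypothesis.

THE STATEMENT (`exists_finImplementer`). Let `(g, M) ∈ Mp_ψ(W_𝔸)` (`adelicMp F ι T`: `M` a linear automorphism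
of `𝒮(𝔸_F^ι) = 𝓢((F ⊗ ℝ)^ι) ⊗ 𝒮((𝔸_F^∞)^ι)` implementing `g ∈ Sp(W_𝔸)` in the Schrödinger model `ρ`), and assume
`y ↦ T y` is onto. Then there is a linear automorphism `M_f` of the FINITE factor `𝒮((𝔸_F^∞)^ι)` such that
`1 ⊗ M_f` implements `g` on the finite Heisenberg elements `h ∈ finHeisenberg T`:
`(1 ⊗ M_f) ρ(h) = ρ(g h) (1 ⊗ M_f)`. This is exactly the hypothesis `hMf` of the tensor stripping theorems
`eq_adelicTensorEnd_archPart_of_mem_adelicMp` / `exists_continuousLinearEquiv_of_mem_adelicMpCont` of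
`AdelicMetaplecticTensorStripping`, which therefore apply to EVERY `(g, M) ∈ Mp_ψ(W_𝔸)`: `M = A_∞ ⊗ M_f`
([Weil1964, Chap. III n° 37–38]: the adelic metaplectic group is the restricted product of the local ones;
[MoeglinVignerasWaldspurger1987, Chap. 2 II.1–II.2, II.9]).

THE CONSTRUCTION (Weil's, through irreducibility rather than unitarity). §1: on `finHeisenberg T` the
Schrödinger operator is a pure tensor `ρ(h) = 1 ⊗ ρ_f(h)` with the FINITE SCHRÖDINGER OPERATOR
`ρ_f(h) = ψ_F(t) · finOp T h = ψ_F(t) ψ_f(Σ_i (T y)_{f,i} ·_i) f(x_f + ·)` (`finSchrodinger`; the dictionary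
`adelicSchrodinger_eq_adelicTensorEnd_finSchrodinger` is `adelicSchrodinger_eq_smul_adelicTensorEnd_finOp` of
`AdelicMetaplecticDirectSum`). §2: the FINITE SLICE `finSliceLM a : φ ⊗ f ↦ φ(a) f` (`AdelicMetaplecticDirectSum`)
is evaluation `u ↦ u(a, ·)` and intertwines `1 ⊗ B` with `B`. §3: the FINITE COEFFICIENT
`N = N_{φ₀,a} : f ↦ (M(φ₀ ⊗ f))(a, ·)` of `M` satisfies `N ρ_f(h) = ρ_f(g h) N` for `h ∈ finHeisenberg T`
(`finCoeff_finSchrodinger`), and some `N_{φ₀,a}` is non-zero (`exists_finCoeff_ne_zero`). §4: since `g` permutes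
`finHeisenberg T` and the finite translations / modulations are among the `ρ_f(h)`, the kernel and the image of
`N` are invariant subspaces, so by the IRREDUCIBILITY of the finite Schrödinger module
(`FiniteAdeleSchrodingerIrreducible`: `injective_of_invariant`, `surjective_of_invariant`) `N` is bijective:
`M_f := N`. §5: two finite implementers of the same `s` differ by a scalar (`exists_smul_of_finImplementer`, Schur:
`eq_smul_id_of_comm`).

## References

* [Weil1964] A. Weil, *Sur certains groupes d'opérateurs unitaires*, Acta Math. 111 (1964), Chap. I n° 4 p. 149
  (the operators), Chap. III n° 37–38 pp. 188–190 (adelic case: restricted products of the local groups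
  `Mp(X_v)`, standard functions `φ ⊗ 𝟙`).
* [MoeglinVignerasWaldspurger1987] C. Mœglin, M.-F. Vignéras, J.-L. Waldspurger, *Correspondances de Howe sur un
  corps p-adique*, LNM 1291 (1987), Chap. 2 I.3 (irréductibilité), II.1 (A)–(B) (`Mp_ψ` as implementing pairs),
  II.2 (the Schrödinger models).
-/

set_option autoImplicit false

noncomputable section

open scoped Matrix SchwartzMap TensorProduct Classical

open NumberField NumberField.mixedEmbedding IsDedekindDomain

namespace Literature.NumberTheory.Weil1964

open Literature.NumberTheory.Automorphic Literature.RepresentationTheory.HeisenbergGroup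

variable {F : Type} [Field F] [NumberField F] {ι : Type}

/-! ### §1 The finite Schrödinger operators and the dictionary `ρ(h) = 1 ⊗ ρ_f(h)` on `finHeisenberg` -/

section FinSchrodinger

variable [Fintype ι] [DecidableEq ι] (T : Matrix ι ι (AdeleRing (𝓞 F) F))

/-- **The finite Schrödinger operator** of `h = ((x, y), t) ∈ H(W_𝔸)` on `𝒮((𝔸_F^∞)^ι)`:
`ρ_f(h) f = ψ_F(t) · ψ_f(Σ_i (T y)_{f,i} b_i) · f(x_f + b)` (modulation by the finite part of `T y` after
translation by the finite part of `x`). For `h ∈ finHeisenberg T` it is the finite tensor factor of `ρ(h)`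
(`adelicSchrodinger_eq_adelicTensorEnd_finSchrodinger`). [cite: Weil1964, Chap. I n° 4 p. 149] -/
def finSchrodinger (h : AdelicHeisenberg F ι T) : FinSB F ι →ₗ[ℂ] FinSB F ι :=
  ((adeleAddChar F h.t : Circle) : ℂ) • finOp T h

/-- `ρ_f(h) = ψ_F(t) · finOp T h` (`finOp` = modulation after translation, `AdelicMetaplecticDirectSum`). [folklore] -/
theorem finSchrodinger_def (h : AdelicHeisenberg F ι T) :
    finSchrodinger T h = ((adeleAddChar F h.t : Circle) : ℂ) • finOp T h := rfl

/-- Pointwise formula for `ρ_f(h)`. [cite: Weil1964, Chap. I n° 4 p. 149] -/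
theorem coe_finSchrodinger_apply (h : AdelicHeisenberg F ι T) (f : FinSB F ι)
    (b : ι → FiniteAdeleRing (𝓞 F) F) :
    ((finSchrodinger T h f : FinSB F ι) : (ι → FiniteAdeleRing (𝓞 F) F) → ℂ) b =
      ((adeleAddChar F h.t : Circle) : ℂ) *
        ((finiteAdeleAddChar F (∑ i, piFinite F ι (T *ᵥ h.v.2) i * b i) : ℂ) *
          (f : (ι → FiniteAdeleRing (𝓞 F) F) → ℂ) (piFinite F ι h.v.1 + b)) := by
  simp only [finSchrodinger, finOp_def, LinearMap.smul_apply, LinearMap.comp_apply, Submodule.coe_smul,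
    Pi.smul_apply, smul_eq_mul, coe_finModulateSB_apply, coe_finTranslateSB_apply]

/-- `ρ_f(((x_k, 0), 0)) = (f ↦ f(k + ·))` for the finite vector `x_k = (0, k)`. [folklore] -/
theorem finSchrodinger_ofVec_inl (k : ι → FiniteAdeleRing (𝓞 F) F) :
    finSchrodinger T (Heisenberg.ofVec (polar (adelicForm F ι T)) (piAdeleSplit F ι (0, k), 0)) =
      finTranslateSB F ι k := by
  apply LinearMap.ext
  intro f
  apply Subtype.ext
  funext b
  rw [coe_finSchrodinger_apply]
  simp only [Heisenberg.ofVec_t, Heisenberg.ofVec_v, AddChar.map_zero_eq_one, Circle.coe_one, one_mul,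
    Matrix.mulVec_zero, piFinite_piAdeleSplit, coe_finTranslateSB_apply]
  rw [show piFinite F ι (0 : ι → AdeleRing (𝓞 F) F) = 0 from rfl]
  simp only [Pi.zero_apply, zero_mul, Finset.sum_const_zero, AddChar.map_zero_eq_one, Circle.coe_one, one_mul]

/-- `ρ_f(((0, y'), 0)) = (f ↦ ψ_f(Σ_i y_i b_i) f)` when `T y' = (0, y)`. [folklore] -/
theorem finSchrodinger_ofVec_inr {y' : ι → AdeleRing (𝓞 F) F} {y : ι → FiniteAdeleRing (𝓞 F) F}
    (hy : T *ᵥ y' = piAdeleSplit F ι (0, y)) :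
    finSchrodinger T (Heisenberg.ofVec (polar (adelicForm F ι T)) (0, y')) = finModulateSB F ι y := by
  apply LinearMap.ext
  intro f
  apply Subtype.ext
  funext b
  rw [coe_finSchrodinger_apply]
  simp only [Heisenberg.ofVec_t, Heisenberg.ofVec_v, AddChar.map_zero_eq_one, Circle.coe_one, one_mul, hy,
    piFinite_piAdeleSplit, coe_finModulateSB_apply]
  rw [show piFinite F ι (0 : ι → AdeleRing (𝓞 F) F) = 0 from rfl, zero_add]

variable {T}

/-- **The dictionary on the finite Heisenberg elements: `ρ(h) = 1 ⊗ ρ_f(h)`** for `h ∈ finHeisenberg T`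
(`ψ_F(t) · (1 ⊗ finOp T h) = 1 ⊗ (ψ_F(t) · finOp T h)`; `adelicSchrodinger_eq_smul_adelicTensorEnd_finOp`).
[cite: Weil1964, Chap. III n° 37 p. 188] -/
theorem adelicSchrodinger_eq_adelicTensorEnd_finSchrodinger {h : AdelicHeisenberg F ι T}
    (hh : h ∈ finHeisenberg T) :
    adelicSchrodinger F ι T h = adelicTensorEnd LinearMap.id (finSchrodinger T h) := by
  rw [finSchrodinger_def, adelicTensorEnd_smul_right]
  exact adelicSchrodinger_eq_smul_adelicTensorEnd_finOp hh

end FinSchrodinger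

/-! ### §2 The finite slice `u ↦ u(a, ·)` -/

section Slice

variable [Fintype ι]

/-- **The slice is evaluation**: `(finSliceLM a u)(b) = u(split (a, b))`. [folklore] -/
theorem finSliceLM_apply_apply (a : ι → mixedSpace F) (u : ↥(piSchwartzBruhat F ι))
    (b : ι → FiniteAdeleRing (𝓞 F) F) :
    ((finSliceLM F ι a u : FinSB F ι) : (ι → FiniteAdeleRing (𝓞 F) F) → ℂ) b =
      (u : (ι → AdeleRing (𝓞 F) F) → ℂ) (piAdeleSplit F ι (a, b)) := by
  let F₁ : ↥(piSchwartzBruhat F ι) →ₗ[ℂ] ℂ :=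
    { toFun := fun u => ((finSliceLM F ι a u : FinSB F ι) : (ι → FiniteAdeleRing (𝓞 F) F) → ℂ) b
      map_add' := fun u u' => by simp only [map_add, Submodule.coe_add, Pi.add_apply]
      map_smul' := fun c u => by simp only [map_smul, Submodule.coe_smul, Pi.smul_apply, RingHom.id_apply] }
  let F₂ : ↥(piSchwartzBruhat F ι) →ₗ[ℂ] ℂ :=
    { toFun := fun u => (u : (ι → AdeleRing (𝓞 F) F) → ℂ) (piAdeleSplit F ι (a, b))
      map_add' := fun _ _ => rfl
      map_smul' := fun _ _ => rfl }
  have h : F₁ = F₂ := linearMap_ext_tensor fun φ f => by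
    show ((finSliceLM F ι a (piSchwartzBruhatEquiv F ι (φ ⊗ₜ f)) : FinSB F ι) :
        (ι → FiniteAdeleRing (𝓞 F) F) → ℂ) b =
      ((piSchwartzBruhatEquiv F ι (φ ⊗ₜ f) : ↥(piSchwartzBruhat F ι)) : (ι → AdeleRing (𝓞 F) F) → ℂ)
        (piAdeleSplit F ι (a, b))
    rw [finSliceLM_tmul, coe_piSchwartzBruhatEquiv_tmul]
    simp only [Submodule.coe_smul, Pi.smul_apply, smul_eq_mul, piArch_piAdeleSplit, piFinite_piAdeleSplit]
  exact LinearMap.congr_fun h u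

/-- **The finite slice intertwines `1 ⊗ B` with `B`**: `(( 1 ⊗ B) u)(a, ·) = B (u(a, ·))`. [folklore] -/
theorem finSliceLM_adelicTensorEnd_id (a : ι → mixedSpace F) (B : FinSB F ι →ₗ[ℂ] FinSB F ι)
    (u : ↥(piSchwartzBruhat F ι)) :
    finSliceLM F ι a (adelicTensorEnd LinearMap.id B u) = B (finSliceLM F ι a u) := by
  have h : finSliceLM F ι a ∘ₗ adelicTensorEnd LinearMap.id B = B ∘ₗ finSliceLM F ι a :=
    linearMap_ext_tensor fun φ f => by
      simp only [LinearMap.comp_apply, adelicTensorEnd_apply_tmul, LinearMap.id_apply, finSliceLM_tmul, map_smul]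
  exact LinearMap.congr_fun h u

end Slice

/-! ### §3 The finite coefficients of an implementer -/

section Coefficient

variable [Fintype ι] [DecidableEq ι] {T : Matrix ι ι (AdeleRing (𝓞 F) F)}

/-- **The finite coefficient** `N_{φ₀,a}(M) : f ↦ (M(φ₀ ⊗ f))(a, ·)` of a linear endomorphism `M` of `𝒮(𝔸_F^ι)`:
an endomorphism of the finite factor `𝒮((𝔸_F^∞)^ι)`. [folklore] -/
def finCoeff (M : ↥(piSchwartzBruhat F ι) →ₗ[ℂ] ↥(piSchwartzBruhat F ι)) (φ₀ : 𝓢((ι → mixedSpace F), ℂ))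
    (a : ι → mixedSpace F) : FinSB F ι →ₗ[ℂ] FinSB F ι :=
  finSliceLM F ι a ∘ₗ M ∘ₗ (piSchwartzBruhatEquiv F ι).toLinearMap ∘ₗ
    TensorProduct.mk ℂ 𝓢((ι → mixedSpace F), ℂ) (FinSB F ι) φ₀

omit [DecidableEq ι] in
/-- Unfolding of `finCoeff`. [folklore] -/
theorem finCoeff_apply (M : ↥(piSchwartzBruhat F ι) →ₗ[ℂ] ↥(piSchwartzBruhat F ι))
    (φ₀ : 𝓢((ι → mixedSpace F), ℂ)) (a : ι → mixedSpace F) (f : FinSB F ι) :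
    finCoeff M φ₀ a f = finSliceLM F ι a (M (piSchwartzBruhatEquiv F ι (φ₀ ⊗ₜ f))) := rfl

/-- **The finite coefficients of an implementer intertwine the finite Schrödinger operators**: if
`M ρ(h) = ρ(s h) M` for `h ∈ finHeisenberg T`, then `N ρ_f(h) = ρ_f(s h) N` for every `N = N_{φ₀,a}(M)`.
[cite: Weil1964, Chap. III n° 37 p. 188] -/
theorem finCoeff_finSchrodinger {M : ↥(piSchwartzBruhat F ι) →ₗ[ℂ] ↥(piSchwartzBruhat F ι)}
    {s : Heisenberg.PseudoSymplectic (polar (adelicForm F ι T))}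
    (hM : ∀ h ∈ finHeisenberg T, ∀ Φ : ↥(piSchwartzBruhat F ι),
      M (adelicSchrodinger F ι T h Φ) = adelicSchrodinger F ι T (s.act h) (M Φ))
    (φ₀ : 𝓢((ι → mixedSpace F), ℂ)) (a : ι → mixedSpace F) {h : AdelicHeisenberg F ι T}
    (hh : h ∈ finHeisenberg T) (f : FinSB F ι) :
    finCoeff M φ₀ a (finSchrodinger T h f) = finSchrodinger T (s.act h) (finCoeff M φ₀ a f) := by
  rw [finCoeff_apply, finCoeff_apply]
  have h1 : piSchwartzBruhatEquiv F ι (φ₀ ⊗ₜ finSchrodinger T h f) =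
      adelicSchrodinger F ι T h (piSchwartzBruhatEquiv F ι (φ₀ ⊗ₜ f)) := by
    rw [adelicSchrodinger_eq_adelicTensorEnd_finSchrodinger hh, adelicTensorEnd_apply_tmul, LinearMap.id_apply]
  rw [h1, hM h hh, adelicSchrodinger_eq_adelicTensorEnd_finSchrodinger (act_mem_finHeisenberg s hh),
    finSliceLM_adelicTensorEnd_id]

omit [DecidableEq ι] in
/-- **Some finite coefficient of a linear AUTOMORPHISM is non-zero**: `M(φ₀ ⊗ 𝟙_{𝒪̂^ι}) ≠ 0` has a non-zero
value `(M(φ₀ ⊗ 𝟙))(a, b)`, and then `N_{φ₀,a}(M) 𝟙 ≠ 0`. [folklore] -/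
theorem exists_finCoeff_ne_zero (M : ↥(piSchwartzBruhat F ι) ≃ₗ[ℂ] ↥(piSchwartzBruhat F ι)) :
    ∃ (φ₀ : 𝓢((ι → mixedSpace F), ℂ)) (a : ι → mixedSpace F),
      finCoeff (M : ↥(piSchwartzBruhat F ι) →ₗ[ℂ] ↥(piSchwartzBruhat F ι)) φ₀ a ≠ 0 := by
  obtain ⟨φ₀, hφ₀⟩ := exists_schwartzMap_apply_zero_eq_one (F := F) ι
  set f₀ : FinSB F ι := indicatorSB F ι (piLevelIdeal F ι ⊤) (isOpen_piLevelIdeal F ⊤)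
    (isCompact_piLevelIdeal F ι ⊤) with hf₀
  have hu₀ : piSchwartzBruhatEquiv F ι (φ₀ ⊗ₜ f₀) ≠ 0 := by
    intro h0
    have h := congrArg (fun u : ↥(piSchwartzBruhat F ι) =>
      (u : (ι → AdeleRing (𝓞 F) F) → ℂ) (piAdeleSplit F ι (0, 0))) h0
    simp only [coe_piSchwartzBruhatEquiv_tmul, piArch_piAdeleSplit, piFinite_piAdeleSplit, hφ₀, one_mul,
      ZeroMemClass.coe_zero, Pi.zero_apply] at h
    rw [hf₀, coe_indicatorSB, Set.indicator_of_mem (show (0 : ι → FiniteAdeleRing (𝓞 F) F) ∈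
      (piLevelIdeal F ι ⊤ : Set _) from (piLevelIdeal F ι ⊤).zero_mem)] at h
    exact one_ne_zero h
  have hM : M (piSchwartzBruhatEquiv F ι (φ₀ ⊗ₜ f₀)) ≠ 0 := fun h => hu₀ ((LinearEquiv.map_eq_zero_iff M).1 h)
  obtain ⟨v, hv⟩ : ∃ v, ((M (piSchwartzBruhatEquiv F ι (φ₀ ⊗ₜ f₀)) : ↥(piSchwartzBruhat F ι)) :
      (ι → AdeleRing (𝓞 F) F) → ℂ) v ≠ 0 := by
    by_contra h
    push Not at h
    exact hM (Subtype.ext (funext fun v => by rw [h v]; rfl))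
  refine ⟨φ₀, piArch F ι v, fun h0 => hv ?_⟩
  have h := congrArg (fun N : FinSB F ι →ₗ[ℂ] FinSB F ι =>
    ((N f₀ : FinSB F ι) : (ι → FiniteAdeleRing (𝓞 F) F) → ℂ) (piFinite F ι v)) h0
  simp only [finCoeff_apply, finSliceLM_apply_apply, LinearMap.zero_apply, ZeroMemClass.coe_zero,
    Pi.zero_apply] at h
  rwa [← eq_piAdeleSplit] at h

end Coefficient

/-! ### §4 The finite implementer -/

section Implementer

variable [Fintype ι] [DecidableEq ι] {T : Matrix ι ι (AdeleRing (𝓞 F) F)}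

/-- **Bijectivity of a non-zero finite coefficient of an implementer.** Let `M ρ(h) = ρ(g h) M` on
`finHeisenberg T` (`g ∈ Sp(W_𝔸)`, `y ↦ T y` onto) and let `N = N_{φ₀,a}(M) ≠ 0`. Then `N` is a linear
bijection of `𝒮((𝔸_F^∞)^ι)`: its kernel and image are stable under the finite translations `ρ_f((x_k,0),0)` and
modulations `ρ_f((0,y'),0)` (`g` permutes `finHeisenberg T`), hence trivial / everything by irreducibility.
[cite: MoeglinVignerasWaldspurger1987, Chap. 2 I.3] -/
theorem bijective_finCoeff (hT : Function.Surjective fun y : ι → AdeleRing (𝓞 F) F => T *ᵥ y)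
    (g : symplecticGroup (polar (adelicForm F ι T)))
    {M : ↥(piSchwartzBruhat F ι) →ₗ[ℂ] ↥(piSchwartzBruhat F ι)}
    (hM : ∀ h ∈ finHeisenberg T, ∀ Φ : ↥(piSchwartzBruhat F ι),
      M (adelicSchrodinger F ι T h Φ) =
        adelicSchrodinger F ι T ((ofSymplectic (polar (adelicForm F ι T)) g).act h) (M Φ))
    {φ₀ : 𝓢((ι → mixedSpace F), ℂ)} {a : ι → mixedSpace F} (hN : finCoeff M φ₀ a ≠ 0) :
    Function.Bijective (finCoeff M φ₀ a) := by
  have hNh : ∀ h ∈ finHeisenberg T, ∀ f : FinSB F ι, finCoeff M φ₀ a (finSchrodinger T h f) =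
      finSchrodinger T ((ofSymplectic (polar (adelicForm F ι T)) g).act h) (finCoeff M φ₀ a f) :=
    fun h hh f => finCoeff_finSchrodinger hM φ₀ a hh f
  -- the finite translations and modulations as `ρ_f(h)`, `h ∈ finHeisenberg T`
  have htr : ∀ k : ι → FiniteAdeleRing (𝓞 F) F, ∃ h ∈ finHeisenberg T, finSchrodinger T h = finTranslateSB F ι k :=
    fun k => ⟨_, ofVec_mem_finHeisenberg (finIdem_smul_piAdeleSplit_zero k) (smul_zero _),
      finSchrodinger_ofVec_inl T k⟩
  have hmod : ∀ y : ι → FiniteAdeleRing (𝓞 F) F, ∃ h ∈ finHeisenberg T, finSchrodinger T h = finModulateSB F ι y := by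
    intro y
    obtain ⟨y', hy', hTy'⟩ := exists_fin_mulVec_eq hT y
    exact ⟨_, ofVec_mem_finHeisenberg (smul_zero _) hy', finSchrodinger_ofVec_inr T hTy'⟩
  -- kernel: invariant under every `ρ_f(h)`, `h ∈ finHeisenberg T`
  have hker : ∀ h ∈ finHeisenberg T, ∀ f : FinSB F ι, finCoeff M φ₀ a f = 0 →
      finCoeff M φ₀ a (finSchrodinger T h f) = 0 := by
    intro h hh f hf
    rw [hNh h hh f, hf, map_zero]
  -- image: invariant under every `ρ_f(h')`, `h' ∈ finHeisenberg T` (`h' = g h`)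
  have hran : ∀ h' ∈ finHeisenberg T, ∀ v : FinSB F ι, ∃ v', finCoeff M φ₀ a v' =
      finSchrodinger T h' (finCoeff M φ₀ a v) := by
    intro h' hh' v
    obtain ⟨h, hh, hgh⟩ := exists_act_eq_of_mem_finHeisenberg g h' hh'
    exact ⟨finSchrodinger T h v, by rw [hNh h hh v, hgh]⟩
  refine ⟨injective_of_invariant _ (fun k f hf => ?_) (fun y f hf => ?_) hN,
    surjective_of_invariant _ (fun k v => ?_) (fun y v => ?_) hN⟩
  · obtain ⟨h, hh, hk⟩ := htr k
    rw [← hk]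
    exact hker h hh f hf
  · obtain ⟨h, hh, hy⟩ := hmod y
    rw [← hy]
    exact hker h hh f hf
  · obtain ⟨h, hh, hk⟩ := htr k
    rw [← hk]
    exact hran h hh v
  · obtain ⟨h, hh, hy⟩ := hmod y
    rw [← hy]
    exact hran h hh v

/-- **The finite implementers of the adelic metaplectic group.** For every `(g, M) ∈ Mp_ψ(W_𝔸)` (and
`y ↦ T y` onto) there is a linear automorphism `M_f` of `𝒮((𝔸_F^∞)^ι)` such that `1 ⊗ M_f` implements `g` on the
finite Heisenberg elements: `(1 ⊗ M_f) ρ(h) = ρ(g h) (1 ⊗ M_f)` for `h ∈ finHeisenberg T` — the hypothesis `hMf`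
of `eq_adelicTensorEnd_archPart_of_mem_adelicMp` and `exists_continuousLinearEquiv_of_mem_adelicMpCont`.
`M_f` is a non-zero finite coefficient `f ↦ (M(φ₀ ⊗ f))(a, ·)` of `M`.
[cite: Weil1964, Chap. III n° 37–38 p. 188–190] -/
theorem exists_finImplementer (hT : Function.Surjective fun y : ι → AdeleRing (𝓞 F) F => T *ᵥ y)
    (p : adelicMp F ι T) :
    ∃ Mf : FinSB F ι ≃ₗ[ℂ] FinSB F ι, ∀ h ∈ finHeisenberg T, ∀ Φ : piSchwartzBruhat F ι,
      adelicTensorEnd LinearMap.id (Mf : FinSB F ι →ₗ[ℂ] FinSB F ι) (adelicSchrodinger F ι T h Φ) =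
        adelicSchrodinger F ι T
          ((ofSymplectic (polar (adelicForm F ι T))
            (p : symplecticGroup (polar (adelicForm F ι T)) × (piSchwartzBruhat F ι ≃ₗ[ℂ] piSchwartzBruhat F ι)).1).act
              h)
          (adelicTensorEnd LinearMap.id (Mf : FinSB F ι →ₗ[ℂ] FinSB F ι) Φ) := by
  set g := (p : symplecticGroup (polar (adelicForm F ι T)) × (piSchwartzBruhat F ι ≃ₗ[ℂ] piSchwartzBruhat F ι)).1
    with hg
  set M := (p : symplecticGroup (polar (adelicForm F ι T)) × (piSchwartzBruhat F ι ≃ₗ[ℂ] piSchwartzBruhat F ι)).2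
    with hMdef
  have hImp : ∀ h ∈ finHeisenberg T, ∀ Φ : ↥(piSchwartzBruhat F ι),
      (M : ↥(piSchwartzBruhat F ι) →ₗ[ℂ] ↥(piSchwartzBruhat F ι)) (adelicSchrodinger F ι T h Φ) =
        adelicSchrodinger F ι T ((ofSymplectic (polar (adelicForm F ι T)) g).act h)
          ((M : ↥(piSchwartzBruhat F ι) →ₗ[ℂ] ↥(piSchwartzBruhat F ι)) Φ) :=
    fun h _ Φ => (mem_MpPsi _ _).1 p.2 h Φ
  obtain ⟨φ₀, a, hN⟩ := exists_finCoeff_ne_zero M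
  have hbij := bijective_finCoeff hT g hImp hN
  refine ⟨LinearEquiv.ofBijective _ hbij, fun h hh Φ => ?_⟩
  have hMf : ((LinearEquiv.ofBijective _ hbij : FinSB F ι ≃ₗ[ℂ] FinSB F ι) : FinSB F ι →ₗ[ℂ] FinSB F ι) =
      finCoeff (M : ↥(piSchwartzBruhat F ι) →ₗ[ℂ] ↥(piSchwartzBruhat F ι)) φ₀ a :=
    LinearMap.ext fun _ => rfl
  have hcomp : finCoeff (M : ↥(piSchwartzBruhat F ι) →ₗ[ℂ] ↥(piSchwartzBruhat F ι)) φ₀ a ∘ₗ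
      finSchrodinger T h =
        finSchrodinger T ((ofSymplectic (polar (adelicForm F ι T)) g).act h) ∘ₗ
          finCoeff (M : ↥(piSchwartzBruhat F ι) →ₗ[ℂ] ↥(piSchwartzBruhat F ι)) φ₀ a :=
    LinearMap.ext fun f => finCoeff_finSchrodinger hImp φ₀ a hh f
  have key := congrArg (fun B : FinSB F ι →ₗ[ℂ] FinSB F ι =>
    adelicTensorEnd (LinearMap.id : 𝓢((ι → mixedSpace F), ℂ) →ₗ[ℂ] 𝓢((ι → mixedSpace F), ℂ)) B) hcomp
  rw [← LinearMap.id_comp (LinearMap.id : 𝓢((ι → mixedSpace F), ℂ) →ₗ[ℂ] 𝓢((ι → mixedSpace F), ℂ)),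
    adelicTensorEnd_comp, adelicTensorEnd_comp] at key
  rw [hMf, adelicSchrodinger_eq_adelicTensorEnd_finSchrodinger hh,
    adelicSchrodinger_eq_adelicTensorEnd_finSchrodinger (act_mem_finHeisenberg _ hh), ← LinearMap.comp_apply,
    key, LinearMap.comp_apply]

end Implementer

/-! ### §5 Uniqueness of the finite implementer up to a scalar -/

section Unique

variable [Fintype ι] [DecidableEq ι] {T : Matrix ι ι (AdeleRing (𝓞 F) F)}

/-- From `(1 ⊗ M_f) ρ(h) = ρ(s h) (1 ⊗ M_f)` on `finHeisenberg T` to `M_f ρ_f(h) = ρ_f(s h) M_f`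
(`B ↦ 1 ⊗ B` is injective). [folklore] -/
theorem comp_finSchrodinger_of_finImplementer {s : Heisenberg.PseudoSymplectic (polar (adelicForm F ι T))}
    {Mf : FinSB F ι →ₗ[ℂ] FinSB F ι}
    (hMf : ∀ h ∈ finHeisenberg T, ∀ Φ : piSchwartzBruhat F ι,
      adelicTensorEnd LinearMap.id Mf (adelicSchrodinger F ι T h Φ) =
        adelicSchrodinger F ι T (s.act h) (adelicTensorEnd LinearMap.id Mf Φ))
    {h : AdelicHeisenberg F ι T} (hh : h ∈ finHeisenberg T) :
    Mf ∘ₗ finSchrodinger T h = finSchrodinger T (s.act h) ∘ₗ Mf := by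
  apply adelicTensorEnd_id_left_injective
  show adelicTensorEnd LinearMap.id (Mf ∘ₗ finSchrodinger T h) =
    adelicTensorEnd LinearMap.id (finSchrodinger T (s.act h) ∘ₗ Mf)
  rw [← LinearMap.id_comp (LinearMap.id : 𝓢((ι → mixedSpace F), ℂ) →ₗ[ℂ] 𝓢((ι → mixedSpace F), ℂ)),
    adelicTensorEnd_comp, adelicTensorEnd_comp, ← adelicSchrodinger_eq_adelicTensorEnd_finSchrodinger hh,
    ← adelicSchrodinger_eq_adelicTensorEnd_finSchrodinger (act_mem_finHeisenberg s hh)]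
  exact LinearMap.ext fun Φ => hMf h hh Φ

/-- **Uniqueness of the finite implementer up to a scalar (Schur).** Two linear automorphisms `M_f`, `M_f'` of
`𝒮((𝔸_F^∞)^ι)` with `1 ⊗ M_f`, `1 ⊗ M_f'` both implementing the same `s` on `finHeisenberg T` (`y ↦ T y` onto)
differ by a scalar: `M_f' = c M_f` (`M_f⁻¹ M_f'` commutes with all finite translations and modulations).
[cite: MoeglinVignerasWaldspurger1987, Chap. 2 II.1 (B)] -/
theorem exists_smul_of_finImplementer (hT : Function.Surjective fun y : ι → AdeleRing (𝓞 F) F => T *ᵥ y)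
    {s : Heisenberg.PseudoSymplectic (polar (adelicForm F ι T))} (Mf Mf' : FinSB F ι ≃ₗ[ℂ] FinSB F ι)
    (hMf : ∀ h ∈ finHeisenberg T, ∀ Φ : piSchwartzBruhat F ι,
      adelicTensorEnd LinearMap.id (Mf : FinSB F ι →ₗ[ℂ] FinSB F ι) (adelicSchrodinger F ι T h Φ) =
        adelicSchrodinger F ι T (s.act h) (adelicTensorEnd LinearMap.id (Mf : FinSB F ι →ₗ[ℂ] FinSB F ι) Φ))
    (hMf' : ∀ h ∈ finHeisenberg T, ∀ Φ : piSchwartzBruhat F ι,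
      adelicTensorEnd LinearMap.id (Mf' : FinSB F ι →ₗ[ℂ] FinSB F ι) (adelicSchrodinger F ι T h Φ) =
        adelicSchrodinger F ι T (s.act h) (adelicTensorEnd LinearMap.id (Mf' : FinSB F ι →ₗ[ℂ] FinSB F ι) Φ)) :
    ∃ c : ℂ, (Mf' : FinSB F ι →ₗ[ℂ] FinSB F ι) = c • (Mf : FinSB F ι →ₗ[ℂ] FinSB F ι) := by
  set C : FinSB F ι →ₗ[ℂ] FinSB F ι :=
    (Mf.symm : FinSB F ι →ₗ[ℂ] FinSB F ι) ∘ₗ (Mf' : FinSB F ι →ₗ[ℂ] FinSB F ι) with hC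
  -- `C = M_f⁻¹ M_f'` commutes with every `ρ_f(h)`, `h ∈ finHeisenberg T`
  have hCh : ∀ h ∈ finHeisenberg T, ∀ f : FinSB F ι, C (finSchrodinger T h f) = finSchrodinger T h (C f) := by
    intro h hh f
    have h1 := comp_finSchrodinger_of_finImplementer hMf hh
    have h2 := LinearMap.congr_fun (comp_finSchrodinger_of_finImplementer hMf' hh) f
    simp only [LinearMap.comp_apply, LinearEquiv.coe_coe] at h2
    have h3 : ∀ f' : FinSB F ι, Mf.symm (finSchrodinger T (s.act h) f') = finSchrodinger T h (Mf.symm f') := by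
      intro f'
      have h5 := LinearMap.congr_fun h1 (Mf.symm f')
      simp only [LinearMap.comp_apply, LinearEquiv.coe_coe, LinearEquiv.apply_symm_apply] at h5
      rw [← h5, LinearEquiv.symm_apply_apply]
    show Mf.symm (Mf' (finSchrodinger T h f)) = finSchrodinger T h (Mf.symm (Mf' f))
    rw [h2, h3]
  have hCtr : ∀ (k : ι → FiniteAdeleRing (𝓞 F) F) (f : FinSB F ι),
      C (finTranslateSB F ι k f) = finTranslateSB F ι k (C f) := by
    intro k f
    obtain ⟨h, hh, hk⟩ : ∃ h ∈ finHeisenberg T, finSchrodinger T h = finTranslateSB F ι k :=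
      ⟨_, ofVec_mem_finHeisenberg (finIdem_smul_piAdeleSplit_zero k) (smul_zero _), finSchrodinger_ofVec_inl T k⟩
    rw [← hk]
    exact hCh h hh f
  have hCmod : ∀ (y : ι → FiniteAdeleRing (𝓞 F) F) (f : FinSB F ι),
      C (finModulateSB F ι y f) = finModulateSB F ι y (C f) := by
    intro y f
    obtain ⟨y', hy', hTy'⟩ := exists_fin_mulVec_eq hT y
    obtain ⟨h, hh, hy⟩ : ∃ h ∈ finHeisenberg T, finSchrodinger T h = finModulateSB F ι y :=
      ⟨_, ofVec_mem_finHeisenberg (smul_zero _) hy', finSchrodinger_ofVec_inr T hTy'⟩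
    rw [← hy]
    exact hCh h hh f
  obtain ⟨c, hc⟩ := eq_smul_id_of_comm C hCtr hCmod
  refine ⟨c, LinearMap.ext fun f => ?_⟩
  have h := LinearMap.congr_fun hc f
  rw [hC] at h
  simp only [LinearMap.comp_apply, LinearEquiv.coe_coe, LinearMap.smul_apply, LinearMap.id_apply] at h
  rw [LinearMap.smul_apply, LinearEquiv.coe_coe, LinearEquiv.coe_coe, ← Mf.apply_symm_apply (Mf' f), h, map_smul]

end Unique

end Literature.NumberTheory.Weil1964
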